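import Literature.Analysis.FluidPDE.FluidComputer.SpecArithmetic

/-!
# Fluid computer blueprint — the TYPE-I NUMBER of a dyadic cascade (where the machine sits among the Liouville barriers)

HONEST FRAMING: low prior, high value-of-information experiment on Tao's machine paradigm; NOT a
claim that NS blows up.

Closed-form bookkeeping, continuing `SpecArithmetic.lean` (no PDE enters). A cascade with spec sheet
`(λ₀, C, α, E₀, η)` has, at generation `n`, energy `E_n = E₀ ηⁿ` at frequency `λ_n = λ₀ 2ⁿ` during a
window of length `T_n = C λ_n^{-α}`, and the time left to the accumulation time `T_*` is comparable
to `T_n` (geometric tail). Under the DICTIONARY ASSUMPTION that the active generation dominates the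
velocity amplitude — `‖u(t)‖_∞ ≈ λ_n^{3/2} E_n^{1/2}` while generation `n` runs (Bernstein at one
dyadic scale; this is where the heuristics live, not in this file) — the quantity that decides the
blow-up RATE is the **Type-I number (squared)**

  `Θ_n = λ_n³ · E_n · T_n ≈ ‖u‖²_∞ · (T_* − t)`,

a geometric sequence of ratio `r = 8 η 2^{-α} = η / 2^{α−3}` (`typeOneSq_eq`):

* `r ≤ 1 ⟺ η ≤ 2^{α−3}`: `Θ_n` bounded — the Type-I envelope `‖u(t)‖_∞ ≲ (T_* − t)^{-1/2}`
  (`typeOneSq_le`); `r = 1 ⟺ η = 2^{α−3}`: exactly the self-similar rate (`typeOneSq_const`);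
* `r > 1 ⟺ η > 2^{α−3}`: `Θ_n → ∞` — TYPE II (`tendsto_typeOneSq_atTop`);
* `r < 1 ⟺ η < 2^{α−3}`: `Θ_n → 0` — slower than Leray's NECESSARY rate
  `‖u(t)‖_∞ ≥ c ν^{1/2} (T_* − t)^{-1/2}` (Leray 1934), i.e. inconsistent with blow-up at `T_*` under
  the dictionary (`tendsto_typeOneSq_zero`). So LERAY-CONSISTENCY of a cascade reads `η ≥ 2^{α−3}`,
  which with `η ≤ 1` forces `α ≤ 3` (`alpha_le_three_of_leray`) and with the viscous threshold
  `α ≥ 2` of `SpecArithmetic.lean` forces `η ≥ 1/2` (`half_le_eta_of_leray`) — the same threshold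
  the dimensional closure gave (`two_le_alphaEff_iff`), reached independently.

THE CORNER. `(α, η) = (2, 1/2)` is the Navier–Stokes scaling: generation `n+1` is the image of
generation `n` under `u ↦ 2u(2x, 4t)` (amplitude `×2`, energy `×1/2`, time `×1/4`), i.e. a
backward DISCRETELY SELF-SIMILAR blow-up, with constant Reynolds number per generation
(`viscousNumber` constant) and exactly the Type-I rate (`r = 1`). Under the dimensional closure
`T_n = c λ_n^{-5/2} E_n^{-1/2}` the two numbers are RECIPROCAL, `Θ_n · (ν λ_n² T_n) = ν c²`
(`typeOne_viscous_reciprocity`), the ratio is `r = √(2η)` (`typeOneRatio_of_closure`), and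
"Type-I envelope AND beats viscosity" pins `η = 1/2` (`corner_iff_of_closure`): every cascade off the
corner that outruns viscosity (`η > 1/2`, Reynolds numbers `→ ∞`) is TYPE II. Tao's averaged machine
(`α = 5/2`, `η ≈ 0.986`) has `r = 8η 2^{-5/2} ≈ 1.39`: Type II, discretely self-similar for the
ENERGY-CONSERVING Euler scaling `u ↦ 2^{3/2} u(2x, 2^{5/2} t)`, not for the Navier–Stokes one. The
blueprint's `ASSEMBLY.md` §2h places the machine against the Type-I / self-similar Liouville
theorems accordingly (they constrain the corner, not the interior).

## References

* J. Leray, *Sur le mouvement d'un liquide visqueux emplissant l'espace*, Acta Math. 63 (1934),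
  193–248 (the lower bound on the blow-up rate, (3.8)). [Leray1934]
* T. Tao, *Finite time blowup for an averaged three-dimensional Navier–Stokes equation*,
  J. Amer. Math. Soc. 29 (2016), §1.3, §6. [Tao2016AveragedNS]
-/

noncomputable section

open Real Filter Topology

namespace Literature.Analysis.FluidPDE.FluidComputer

namespace CascadeSpecs

variable (S : CascadeSpecs)

/-! ### One-step recursions of the spec sheet -/

/-- `E_{n+1} = η E_n`. [folklore] -/
theorem Emin_succ (n : ℕ) : S.Emin (n + 1) = S.eta * S.Emin n := by
  unfold Emin; rw [pow_succ]; ring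

/-- `T_{n+1} = 2^{-α} T_n`. [folklore] -/
theorem Tmax_succ (n : ℕ) : S.Tmax (n + 1) = (2 : ℝ) ^ (-S.alpha) * S.Tmax n := by
  unfold Tmax
  rw [S.lam_succ, Real.mul_rpow zero_le_two (S.lam_pos n).le]
  ring

/-! ### The Type-I number -/

/-- The **Type-I number (squared)** of generation `n`: `Θ_n = λ_n³ E_n T_n` — under the one-scale
Bernstein dictionary `‖u‖²_∞ ≈ λ_n³ E_n`, the size of `‖u(t)‖²_∞ (T_* − t)` while generation `n`
runs. Bounded ⟺ Type-I envelope; `→ ∞` ⟺ Type II; `→ 0` ⟺ below Leray's necessary rate. [cite: Leray1934, (3.8)] -/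
def typeOneSq (n : ℕ) : ℝ := S.lam n ^ 3 * S.Emin n * S.Tmax n

/-- `Θ_n > 0`. [folklore] -/
theorem typeOneSq_pos (n : ℕ) : 0 < S.typeOneSq n :=
  mul_pos (mul_pos (pow_pos (S.lam_pos n) 3) (S.Emin_pos n)) (S.Tmax_pos n)

/-- The **Type-I ratio** `r = 8 η 2^{-α}`: `Θ_{n+1} = r Θ_n`. [folklore] -/
def typeOneRatio : ℝ := 8 * S.eta * (2 : ℝ) ^ (-S.alpha)

/-- `r > 0`. [folklore] -/
theorem typeOneRatio_pos : 0 < S.typeOneRatio :=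
  mul_pos (mul_pos (by norm_num) S.eta_pos) (Real.rpow_pos_of_pos two_pos _)

/-- `Θ_{n+1} = r Θ_n` (`λ ↦ 2λ`, `E ↦ ηE`, `T ↦ 2^{-α} T`). [folklore] -/
theorem typeOneSq_succ (n : ℕ) : S.typeOneSq (n + 1) = S.typeOneRatio * S.typeOneSq n := by
  unfold typeOneSq typeOneRatio
  rw [S.lam_succ, S.Emin_succ, S.Tmax_succ]
  ring

/-- **`Θ_n = Θ₀ rⁿ`** — a geometric sequence. [folklore] -/
theorem typeOneSq_eq (n : ℕ) : S.typeOneSq n = S.typeOneSq 0 * S.typeOneRatio ^ n := by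
  induction n with
  | zero => simp
  | succ n ih => rw [S.typeOneSq_succ, ih, pow_succ]; ring

/-- `2^{α−3} = 2^α / 8`. [folklore] -/
theorem two_rpow_sub_three : (2 : ℝ) ^ (S.alpha - 3) = (2 : ℝ) ^ S.alpha / 8 := by
  rw [Real.rpow_sub two_pos, show (3 : ℝ) = ((3 : ℕ) : ℝ) by norm_num, Real.rpow_natCast]
  norm_num

/-- `r = η / 2^{α−3}`. [folklore] -/
theorem typeOneRatio_eq_div : S.typeOneRatio = S.eta / (2 : ℝ) ^ (S.alpha - 3) := by
  unfold typeOneRatio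
  rw [S.two_rpow_sub_three, Real.rpow_neg zero_le_two]
  have h : (0 : ℝ) < (2 : ℝ) ^ S.alpha := Real.rpow_pos_of_pos two_pos _
  field_simp

/-- **Type-I envelope ⟺ `η ≤ 2^{α−3}`** (`r ≤ 1`). [folklore] -/
theorem typeOneRatio_le_one_iff : S.typeOneRatio ≤ 1 ↔ S.eta ≤ (2 : ℝ) ^ (S.alpha - 3) := by
  rw [S.typeOneRatio_eq_div, div_le_one (Real.rpow_pos_of_pos two_pos _)]

/-- `r < 1 ⟺ η < 2^{α−3}`. [folklore] -/
theorem typeOneRatio_lt_one_iff : S.typeOneRatio < 1 ↔ S.eta < (2 : ℝ) ^ (S.alpha - 3) := by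
  rw [S.typeOneRatio_eq_div, div_lt_one (Real.rpow_pos_of_pos two_pos _)]

/-- `r > 1 ⟺ η > 2^{α−3}`. [folklore] -/
theorem one_lt_typeOneRatio_iff : 1 < S.typeOneRatio ↔ (2 : ℝ) ^ (S.alpha - 3) < S.eta := by
  rw [S.typeOneRatio_eq_div, one_lt_div (Real.rpow_pos_of_pos two_pos _)]

/-- `r = 1 ⟺ η = 2^{α−3}` (the self-similar rate). [folklore] -/
theorem typeOneRatio_eq_one_iff : S.typeOneRatio = 1 ↔ S.eta = (2 : ℝ) ^ (S.alpha - 3) := by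
  rw [S.typeOneRatio_eq_div, div_eq_one_iff_eq (Real.rpow_pos_of_pos two_pos _).ne']

/-- **TYPE-I ENVELOPE**: for `η ≤ 2^{α−3}` the Type-I numbers are bounded by the first one,
`Θ_n ≤ Θ₀` (`‖u(t)‖²_∞ (T_* − t) ≲ 1` along the cascade, under the dictionary). [cite: Leray1934, (3.8)] -/
theorem typeOneSq_le (h : S.eta ≤ (2 : ℝ) ^ (S.alpha - 3)) (n : ℕ) : S.typeOneSq n ≤ S.typeOneSq 0 := by
  rw [S.typeOneSq_eq n]
  exact mul_le_of_le_one_right (S.typeOneSq_pos 0).le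
    (pow_le_one₀ S.typeOneRatio_pos.le (S.typeOneRatio_le_one_iff.2 h))

/-- **SELF-SIMILAR RATE**: for `η = 2^{α−3}` the Type-I numbers are constant. [folklore] -/
theorem typeOneSq_const (h : S.eta = (2 : ℝ) ^ (S.alpha - 3)) (n : ℕ) : S.typeOneSq n = S.typeOneSq 0 := by
  rw [S.typeOneSq_eq n, S.typeOneRatio_eq_one_iff.2 h, one_pow, mul_one]

/-- **TYPE II**: for `η > 2^{α−3}` the Type-I numbers diverge (`‖u(t)‖²_∞ (T_* − t) → ∞` along the
cascade, under the dictionary). [folklore] -/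
theorem tendsto_typeOneSq_atTop (h : (2 : ℝ) ^ (S.alpha - 3) < S.eta) :
    Tendsto S.typeOneSq atTop atTop := by
  have hlim : Tendsto (fun n : ℕ => S.typeOneSq 0 * S.typeOneRatio ^ n) atTop atTop :=
    (tendsto_pow_atTop_atTop_of_one_lt (S.one_lt_typeOneRatio_iff.2 h)).const_mul_atTop
      (S.typeOneSq_pos 0)
  exact hlim.congr fun n => (S.typeOneSq_eq n).symm

/-- **BELOW LERAY'S RATE**: for `η < 2^{α−3}` the Type-I numbers tend to zero — under the dictionary
the amplitude would grow slower than Leray's necessary rate `‖u(t)‖_∞ ≥ c ν^{1/2} (T_* − t)^{-1/2}`,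
so such a cascade cannot be the whole story of a blow-up at `T_*`. [cite: Leray1934, (3.8)] -/
theorem tendsto_typeOneSq_zero (h : S.eta < (2 : ℝ) ^ (S.alpha - 3)) :
    Tendsto S.typeOneSq atTop (𝓝 0) := by
  have hlim : Tendsto (fun n : ℕ => S.typeOneSq 0 * S.typeOneRatio ^ n) atTop
      (𝓝 (S.typeOneSq 0 * 0)) :=
    (tendsto_pow_atTop_nhds_zero_of_lt_one S.typeOneRatio_pos.le
      (S.typeOneRatio_lt_one_iff.2 h)).const_mul _
  rw [mul_zero] at hlim
  exact hlim.congr fun n => (S.typeOneSq_eq n).symm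

/-! ### Leray-consistency and the viscous threshold -/

/-- **Leray-consistency forces `α ≤ 3`**: `2^{α−3} ≤ η ≤ 1`. [cite: Leray1934, (3.8)] -/
theorem alpha_le_three_of_leray (h : (2 : ℝ) ^ (S.alpha - 3) ≤ S.eta) : S.alpha ≤ 3 := by
  have h1 : (2 : ℝ) ^ (S.alpha - 3) ≤ (2 : ℝ) ^ (0 : ℝ) := by
    rw [Real.rpow_zero]; exact h.trans S.eta_le_one
  have := (Real.rpow_le_rpow_left_iff one_lt_two).1 h1
  linarith

/-- **Leray-consistency plus the viscous threshold force `η ≥ 1/2`**: if the cascade outruns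
viscosity (`α ≥ 2`, `SpecArithmetic.viscousNumber_le`) and is not below Leray's rate
(`η ≥ 2^{α−3}`), then at least half the energy is handed down each generation — the threshold the
dimensional closure gave (`two_le_alphaEff_iff`), obtained without it. [cite: Leray1934, (3.8)] -/
theorem half_le_eta_of_leray (hα : 2 ≤ S.alpha) (h : (2 : ℝ) ^ (S.alpha - 3) ≤ S.eta) :
    1 / 2 ≤ S.eta := by
  have h1 : (2 : ℝ) ^ (-1 : ℝ) ≤ (2 : ℝ) ^ (S.alpha - 3) :=
    Real.rpow_le_rpow_of_exponent_le one_le_two (by linarith)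
  have h2 : (2 : ℝ) ^ (-1 : ℝ) = 1 / 2 := by rw [Real.rpow_neg_one]; norm_num
  rw [h2] at h1
  exact h1.trans h

/-- **THE CORNER without closure**: Type-I envelope (`η ≤ 2^{α−3}`) and outrunning viscosity
(`α ≥ 2`) together force `η ≥ 1/2`... and conversely the Type-I envelope with `η ≥ 1/2` forces
`α ≥ 2`: on the Type-I boundary `η = 2^{α−3}`, `α = 2 ⟺ η = 1/2` — the Navier–Stokes scaling
`u ↦ 2u(2x,4t)` (backward discretely self-similar blow-up). [folklore] -/
theorem corner_of_selfSimilar (h : S.eta = (2 : ℝ) ^ (S.alpha - 3)) : S.alpha = 2 ↔ S.eta = 1 / 2 := by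
  constructor
  · intro hα; rw [h, hα]; norm_num [Real.rpow_neg_one, show (2 : ℝ) - 3 = -1 by norm_num]
  · intro hη
    have h1 : (2 : ℝ) ^ (S.alpha - 3) = (2 : ℝ) ^ (-1 : ℝ) := by
      rw [← h, hη, Real.rpow_neg_one]; norm_num
    have h2 : S.alpha - 3 ≤ -1 := (Real.rpow_le_rpow_left_iff one_lt_two).1 h1.le
    have h3 : -1 ≤ S.alpha - 3 := (Real.rpow_le_rpow_left_iff one_lt_two).1 h1.ge
    linarith

/-! ### Under the dimensional closure: reciprocity with the viscous number -/

/-- **RECIPROCITY**: with the dimensional (eddy turn-over) window `τ_n = c λ_n^{-5/2} E_n^{-1/2}` in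
place of `T_n`, the Type-I number and the viscous number are reciprocal:
`(λ_n³ E_n τ_n) · (ν λ_n² τ_n) = ν c²`. So along a dimensional cascade, Reynolds numbers `→ ∞`
(viscous numbers `→ 0`) is the SAME statement as Type II (`Θ_n → ∞`). [cite: Tao2016AveragedNS, §6 (6.6)] -/
theorem typeOne_viscous_reciprocity (c ν : ℝ) (n : ℕ) :
    (S.lam n ^ 3 * S.Emin n * S.dimensionalTime c n) * (ν * S.lam n ^ 2 * S.dimensionalTime c n) =
      ν * c ^ 2 := by
  unfold dimensionalTime
  have hl : S.lam n ^ (-(5 / 2 : ℝ)) * S.lam n ^ (-(5 / 2 : ℝ)) = (S.lam n ^ 5)⁻¹ := by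
    rw [← Real.rpow_add (S.lam_pos n), show (-(5 / 2 : ℝ)) + -(5 / 2 : ℝ) = -((5 : ℕ) : ℝ) by norm_num,
      Real.rpow_neg (S.lam_pos n).le, Real.rpow_natCast]
  have hE : S.Emin n ^ (-(1 / 2 : ℝ)) * S.Emin n ^ (-(1 / 2 : ℝ)) = (S.Emin n)⁻¹ := by
    rw [← Real.rpow_add (S.Emin_pos n), show (-(1 / 2 : ℝ)) + -(1 / 2 : ℝ) = -1 by norm_num,
      Real.rpow_neg_one]
  have hl0 : S.lam n ^ 5 ≠ 0 := pow_ne_zero 5 (S.lam_pos n).ne'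
  have hE0 : S.Emin n ≠ 0 := (S.Emin_pos n).ne'
  calc S.lam n ^ 3 * S.Emin n * (c * S.lam n ^ (-(5 / 2 : ℝ)) * S.Emin n ^ (-(1 / 2 : ℝ))) *
        (ν * S.lam n ^ 2 * (c * S.lam n ^ (-(5 / 2 : ℝ)) * S.Emin n ^ (-(1 / 2 : ℝ))))
      = ν * c ^ 2 * (S.lam n ^ 5 * (S.lam n ^ (-(5 / 2 : ℝ)) * S.lam n ^ (-(5 / 2 : ℝ)))) *
          (S.Emin n * (S.Emin n ^ (-(1 / 2 : ℝ)) * S.Emin n ^ (-(1 / 2 : ℝ)))) := by ring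
    _ = ν * c ^ 2 := by rw [hl, hE, mul_inv_cancel₀ hl0, mul_inv_cancel₀ hE0]; ring

/-- **Under the closure `α = α_eff` the Type-I ratio is `√(2η)`**. [folklore] -/
theorem typeOneRatio_of_closure (h : S.alpha = S.alphaEff) : S.typeOneRatio = Real.sqrt (2 * S.eta) := by
  unfold typeOneRatio
  rw [h, S.two_rpow_neg_alphaEff]
  have h1 : (8 : ℝ) * (2 : ℝ) ^ (-(5 / 2 : ℝ)) = Real.sqrt 2 := by
    rw [show (8 : ℝ) = (2 : ℝ) ^ (3 : ℝ) by
        rw [show (3 : ℝ) = ((3 : ℕ) : ℝ) by norm_num, Real.rpow_natCast]; norm_num,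
      ← Real.rpow_add two_pos, Real.sqrt_eq_rpow]
    norm_num
  have h2 : S.eta * S.eta ^ (-(1 / 2 : ℝ)) = Real.sqrt S.eta := by
    rw [Real.sqrt_eq_rpow]
    conv_lhs => rw [show S.eta * S.eta ^ (-(1 / 2 : ℝ)) = S.eta ^ (1 : ℝ) * S.eta ^ (-(1 / 2 : ℝ)) by
      rw [Real.rpow_one]]
    rw [← Real.rpow_add S.eta_pos]
    norm_num
  calc 8 * S.eta * ((2 : ℝ) ^ (-(5 / 2 : ℝ)) * S.eta ^ (-(1 / 2 : ℝ)))
      = (8 * (2 : ℝ) ^ (-(5 / 2 : ℝ))) * (S.eta * S.eta ^ (-(1 / 2 : ℝ))) := by ring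
    _ = Real.sqrt 2 * Real.sqrt S.eta := by rw [h1, h2]
    _ = Real.sqrt (2 * S.eta) := (Real.sqrt_mul zero_le_two S.eta).symm

/-- **Under the closure: Type-I envelope ⟺ `η ≤ 1/2`**. [folklore] -/
theorem typeOneRatio_le_one_iff_of_closure (h : S.alpha = S.alphaEff) :
    S.typeOneRatio ≤ 1 ↔ S.eta ≤ 1 / 2 := by
  rw [S.typeOneRatio_of_closure h, Real.sqrt_le_left zero_le_one, one_pow]
  constructor <;> intro h' <;> linarith

/-- **THE CORNER under the closure**: a dimensional cascade is in the Type-I envelope AND outruns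
viscosity (`α_eff ≥ 2`) iff `η = 1/2` exactly — constant Reynolds number, Navier–Stokes-self-similar.
Every dimensional cascade with `η > 1/2` (Tao's machine: `η ≈ 0.986`) is Type II with Reynolds
numbers `→ ∞`; every one with `η < 1/2` is killed by viscosity (`SpecArithmetic`). [folklore] -/
theorem corner_iff_of_closure (h : S.alpha = S.alphaEff) :
    (S.typeOneRatio ≤ 1 ∧ 2 ≤ S.alpha) ↔ S.eta = 1 / 2 := by
  rw [S.typeOneRatio_le_one_iff_of_closure h, h, S.two_le_alphaEff_iff]
  constructor
  · rintro ⟨h1, h2⟩; exact le_antisymm h1 h2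
  · intro hη; exact ⟨hη.le, hη.ge⟩

end CascadeSpecs

end Literature.Analysis.FluidPDE.FluidComputer

end
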